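import Mathlib
import Summits.ValiantsHypothesis.ValiantsHypothesis.Theorems.LacunarySymmetroidMatrixDescartesGramDualSigned
import Summits.ValiantsHypothesis.ValiantsHypothesis.Theorems.LacunarySymmetroidMatrixDescartesGramDualFamily

/-!
# `MatrixDescartes` (stmt-ValiantsHypothesis-18050) — Gram duality, part 10: PSD-LETTER CURRENCY — pairwise
# `J⁻¹`-orthogonal positive semidefinite letters around a non-degenerate pivot are ADDITIVE, hence `Z₊ ≤ K·m`

HONEST FRAMING.  Cell `pub-symmetroid`, seat `val-sym-mdr-p2` (gen 19); helper file `--supports` the crux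
`Theses.LacunarySymmetroid.MatrixDescartes` (OPEN), NO closure claim; companion of `…GramDualFamily` (splitting law
for families, one-letter bound).  The crux's own currency (`Cruxes/MatrixDescartes/Lines/Lift.lean`: pivot `X^e J`
plus PSD letters `X^{d_k} P_k`), with the letters given in factored form `P_k = B_kᵀ B_k` (`B_k : ι × ι`; every PSD
matrix is of this form, tree `Literature.LinearAlgebra.Matrix.exists_eq_conjTranspose_mul_self_of_posSemidef`).
Nothing here bears on the crux in its window, `stub_twoSided`, `DoorA26` / `DoorA34`, registers, or `VP ≠ VNP`.

* `psdLetter_eq_signedPart` — `X^d • (BᵀB) = Bᵀ · diag(1·X^d) · B` (a PSD letter is a signed column system with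
  columns the rows of `B`, all signs `+1`, one exponent).
* **`card_posRoots_psdLetters_split_le` (ADDITIVITY).**  `det J ≠ 0` (no symmetry / sign hypothesis on the pivot);
  PSD letters `P_k = B_kᵀB_k` at ARBITRARY exponents `d_k` (both sides of `e`, ties allowed) whose ranges are pairwise
  `J⁻¹`-ORTHOGONAL (`B_k J⁻¹ B_k'ᵀ = 0`, `k ≠ k'`) ⇒
  `Z₊(X^eJ + Σ_k X^{d_k}P_k) ≤ Σ_k Z₊(X^eJ + X^{d_k}P_k)`.
* **`card_posRoots_psdLetters_le_mul` (`Z₊ ≤ K·m`).**  Under the same hypothesis `Z₊ ≤ card κ · card ι`: «Descartes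
  with multiplicity `m`» holds on the sector of pairwise `J⁻¹`-orthogonal PSD letters, for every pivot, every size and
  every exponent configuration — a K-DEPENDENT two-sided law (the tree's two-sided laws need one-sidedness, a
  negative moment, one letter per side, or commuting letters AND pivot).
READING: `J⁻¹`-orthogonality of ranges is the exact condition under which letters do not interact (the dual word is
block-diagonal); the general signed form (indefinite letters `S = B₊ᵀB₊ − B₋ᵀB₋`, column type `ι ⊕ ι`) is
`GramDual.card_posRoots_family_le`.

[folklore] (block determinants + degree count).  Axioms `propext`, `Classical.choice`, `Quot.sound`.
-/

-- layout Summits/ValiantsHypothesis/ValiantsHypothesis forces the duplicated namespace component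
set_option linter.dupNamespace false

namespace Summit.ValiantsHypothesis.ValiantsHypothesis.Theorems.LacunarySymmetroidMatrixDescartes

open Polynomial Matrix Finset
open scoped BigOperators

namespace GramDual

variable {ι κ : Type*} [Fintype ι] [DecidableEq ι] [Fintype κ] [DecidableEq κ]

/-- the signed column part (file-local notation, as in `…GramDualSigned`) -/
local notation3 (prettyPrint := false) "𝕊[" U ", " σ ", " δ "]" =>
  ((U : Matrix _ _ ℝ).map Polynomial.C
      * Matrix.diagonal (fun j => Polynomial.C ((σ : _ → ℝ) j) * (Polynomial.X : Polynomial ℝ) ^ (δ j : ℕ))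
      * ((U : Matrix _ _ ℝ).map Polynomial.C)ᵀ)

/-- the signed primal word (file-local notation, as in `…GramDualSigned`) -/
local notation3 (prettyPrint := false) "𝔽ₛ[" e ", " B ", " U ", " σ ", " δ "]" =>
  (((Polynomial.X : Polynomial ℝ) ^ (e : ℕ)) • (B : Matrix _ _ ℝ).map Polynomial.C + 𝕊[U, σ, δ])

omit [Fintype κ] [DecidableEq κ] in
/-- **A PSD letter is a signed column system**: `X^d • (BᵀB) = Bᵀ · diag(1 · X^d) · B` (columns = rows of `B`,
signs `+1`). [folklore] -/
theorem psdLetter_eq_signedPart (d : ℕ) (B : Matrix ι ι ℝ) :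
    ((Polynomial.X : Polynomial ℝ) ^ d) • (Bᵀ * B).map Polynomial.C = 𝕊[Bᵀ, (fun _ : ι => (1 : ℝ)), (fun _ : ι => d)] := by
  have hdiag : Matrix.diagonal (fun _ : ι => Polynomial.C (1 : ℝ) * (Polynomial.X : Polynomial ℝ) ^ d)
      = ((Polynomial.X : Polynomial ℝ) ^ d) • (1 : Matrix ι ι (Polynomial ℝ)) := by
    rw [← Matrix.diagonal_one, ← Matrix.diagonal_smul]
    congr 1
    funext x
    rw [Pi.smul_apply, smul_eq_mul, mul_one, map_one, one_mul]
  have ht : ((Bᵀ).map Polynomial.C)ᵀ = B.map Polynomial.C := Matrix.ext fun i j => rfl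
  rw [hdiag, Matrix.mul_smul, Matrix.mul_one, Matrix.smul_mul, ht, Matrix.map_mul]

/-- **ADDITIVITY OF PAIRWISE `J⁻¹`-ORTHOGONAL PSD LETTERS.**  `det J ≠ 0`; PSD letters `P_k = B_kᵀB_k` at exponents
`d_k` with `B_k J⁻¹ B_k'ᵀ = 0` for `k ≠ k'`:
`Z₊(X^eJ + Σ_k X^{d_k}P_k) ≤ Σ_k Z₊(X^eJ + X^{d_k}P_k)`. [folklore] -/
theorem card_posRoots_psdLetters_split_le (J : Matrix ι ι ℝ) (hJ : IsUnit J.det) (e : ℕ) (d : κ → ℕ)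
    (B : κ → Matrix ι ι ℝ) (horth : ∀ k k', k ≠ k' → B k * J⁻¹ * (B k')ᵀ = 0) :
    ((Matrix.det (((Polynomial.X : Polynomial ℝ) ^ e) • J.map Polynomial.C
        + ∑ k, ((Polynomial.X : Polynomial ℝ) ^ d k) • ((B k)ᵀ * B k).map Polynomial.C)
        ).roots.toFinset.filter (fun t => 0 < t)).card
      ≤ ∑ k, ((Matrix.det (((Polynomial.X : Polynomial ℝ) ^ e) • J.map Polynomial.C
            + ((Polynomial.X : Polynomial ℝ) ^ d k) • ((B k)ᵀ * B k).map Polynomial.C)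
            ).roots.toFinset.filter (fun t => 0 < t)).card := by
  classical
  have hk : ∀ k, ((Polynomial.X : Polynomial ℝ) ^ d k) • ((B k)ᵀ * B k).map Polynomial.C
      = 𝕊[(B k)ᵀ, (fun _ : ι => (1 : ℝ)), (fun _ : ι => d k)] := fun k => psdLetter_eq_signedPart (d k) (B k)
  simp only [hk]
  refine card_posRoots_family_le J hJ (fun k => (B k)ᵀ) (fun _ _ => (1 : ℝ)) (fun _ _ => one_ne_zero) e
    (fun k _ => d k) fun k k' hkk' => ?_
  rw [Matrix.transpose_transpose]
  exact horth k k' hkk'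

/-- **`Z₊ ≤ K · m` FOR PAIRWISE `J⁻¹`-ORTHOGONAL PSD LETTERS** (every pivot with `det J ≠ 0`, every size, all
exponents): `Z₊(X^eJ + Σ_k X^{d_k} B_kᵀB_k) ≤ card κ · card ι` when `B_k J⁻¹ B_k'ᵀ = 0` for `k ≠ k'`. [folklore] -/
theorem card_posRoots_psdLetters_le_mul (J : Matrix ι ι ℝ) (hJ : IsUnit J.det) (e : ℕ) (d : κ → ℕ)
    (B : κ → Matrix ι ι ℝ) (horth : ∀ k k', k ≠ k' → B k * J⁻¹ * (B k')ᵀ = 0) :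
    ((Matrix.det (((Polynomial.X : Polynomial ℝ) ^ e) • J.map Polynomial.C
        + ∑ k, ((Polynomial.X : Polynomial ℝ) ^ d k) • ((B k)ᵀ * B k).map Polynomial.C)
        ).roots.toFinset.filter (fun t => 0 < t)).card
      ≤ Fintype.card κ * Fintype.card ι := by
  classical
  have hk : ∀ k, ((Polynomial.X : Polynomial ℝ) ^ d k) • ((B k)ᵀ * B k).map Polynomial.C
      = 𝕊[(B k)ᵀ, (fun _ : ι => (1 : ℝ)), (fun _ : ι => d k)] := fun k => psdLetter_eq_signedPart (d k) (B k)
  simp only [hk]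
  refine card_posRoots_orthogonalLetters_le J hJ (fun k => (B k)ᵀ) (fun _ _ => (1 : ℝ)) (fun _ _ => one_ne_zero) e
    d fun k k' hkk' => ?_
  rw [Matrix.transpose_transpose]
  exact horth k k' hkk'

/-- **One PSD letter against a non-degenerate pivot**: `Z₊(X^eJ + X^d BᵀB) ≤ card ι`, whatever `d` and `e`.
[folklore] -/
theorem card_posRoots_onePsdLetter_le (J : Matrix ι ι ℝ) (hJ : IsUnit J.det) (e d : ℕ) (B : Matrix ι ι ℝ) :
    ((Matrix.det (((Polynomial.X : Polynomial ℝ) ^ e) • J.map Polynomial.C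
        + ((Polynomial.X : Polynomial ℝ) ^ d) • (Bᵀ * B).map Polynomial.C)
        ).roots.toFinset.filter (fun t => 0 < t)).card ≤ Fintype.card ι := by
  rw [psdLetter_eq_signedPart]
  exact card_posRoots_oneLetter_le J hJ Bᵀ (fun _ => (1 : ℝ)) (fun _ => one_ne_zero) e d

end GramDual

end Summit.ValiantsHypothesis.ValiantsHypothesis.Theorems.LacunarySymmetroidMatrixDescartes
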